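import Summits.CriticalPhenomena.PercolationContinuityZ3.Theorems.PercNearOneGluingNoHeavyRsw3SealedClusters
import HarnessLib

/-!
# RSW3 lane (P2, gen 22): BCKS CLUSTER MOMENTS, IX — THE LOWER HALF OF BCKS THM 2 AND `k` DISTINCT MACROSCOPIC CLUSTERS AT `p_c`:
# (A2)□ + annulus blocking ⇒ `E_{p_c} N_{λs(m)}(Λ_N) ≥ c ((2N+1)/(2m+1))^d` and `P_{p_c}(k ≤ N_{ε_k s(N)}(Λ_N)) ≥ c_k > 0`
# (`ℤ³`: under `X_B`; `ℤ²`: UNCONDITIONAL — with part V, `E_{1/2} N_{λs(m)}(Λ_N) ≍ (N/m)²`)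

builds on p205010 (kernel theorem, internal audit signed; external expert review pending) — NOT used in this file.

Cell `prim-rsw3`, prover seat `prim-rsw3-p2` (gen 22), memo `run/shared/lean/prim/rsw3/P2-RSWLITE.md` §29.
Support file (`--supports stmt-CriticalPhenomena-4575`); no definitions, no named facts, no sorries.

`N_a(Λ_N)` = the number of open clusters with `≥ a` sites in `Λ(N)` (part III), `s(m) = (2m+1)^d π_{p_c}(m)`.  BCKS (CMP 2001; Chayes'
ICM 1998 report, Thm. 2): `C₁ (n/m)^d ≤ E N_{Λ_n}(s(m), s(km)) ≤ C₂ (n/m)^d` under the Scaling Axioms (verified in `d = 2`).  Part V gave the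
upper half from (A2)□ alone; here the LOWER half from (A2)□ + annulus blocking (part VIII's sealed fat clusters on a grid of `≍ (N/m)^d`
centres), and `k` distinct macroscopic clusters with positive probability for every `k`:
* `exists_half_le_real_fatUnion_of_setToSetQuasiMultAspectAt` — (A2)□ ⇒ `∃ λ > 0, a ≥ 1 ∀ n ≥ 1: P_{p_c}(U(Λ(a(2n+1)), n, λs(n))) ≥ 1/2`;
* **`exists_le_integral_numFat_scale_of_setToSetQuasiMultAspectAt`**: (A2)□ + [`c_B ≤ 1 − P_{p_c}(boxCrossing d m (3m+3))` ∀ m ≥ 1] ⇒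
  `∃ λ, c > 0, C₀ ∀ n ≥ 1 ∀ N ≥ C₀(2n+1): c·((2N+1)/(2n+1))^d ≤ E_{p_c} N_{λ s(n)}(Λ_N)` — with part V: **`E N_{λs(n)}(Λ_N) ≍ (N/n)^d`**;
* **`exists_le_real_le_numFat_of_setToSetQuasiMultAspectAt`**: ⇒ `∀ k ∃ ε, c > 0, N₀ ∀ N ≥ N₀: c ≤ P_{p_c}(k ≤ N_{ε s(N)}(Λ_N))` (BCKS Thm 1.1 (i)
  for every `i`, lower half, in probability).  Part X: `ℤ³` under `X_B` ∧ (A2)□, and `ℤ²` UNCONDITIONALLY.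

References: Borgs–Chayes–Kesten–Spencer, CMP 224 (2001) Thm. 1.1; Chayes, Doc. Math. ICM 1998 III, Thms. 1–2 [BorgsChayesKestenSpencer2001];
Aizenman, Nucl. Phys. B 485 (1997), Thm. 1 [Aizenman1997]; Grimmett, *Percolation* (1999) §11.7 [GrimmettPercolation1999]; Basu–Sapozhnikov,
ECP 22 (2017) §1 (A2) [BasuSapozhnikov2017ECP]. [folklore]
-/

noncomputable section

namespace Summit.CriticalPhenomena.PercolationContinuityZ3.Theorems

namespace Rsw3

open MeasureTheory Literature.Probability.LatticeModels Literature.Probability.Percolation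
open SurfaceTension Crossing SimpleGraph Finset

variable {d : ℕ}

/-! ## The fat union has probability `≥ 1/2` on boxes of radius `a(2n+1)` -/

open Classical in
/-- **(A2)□ ⇒ the fat union is likely**: `∃ λ > 0, a ≥ 1 ∀ n ≥ 1: 1/2 ≤ P_{p_c}(⋃_{x ∈ Λ(a(2n+1))} FAT(x, n, λ(2n+1)^dπ_{p_c}(n)))` — gen 19's
local fat clusters (`P ≥ c₄π(n)`), the upper hyperscaling inequality (`Σ_{Λ(8n)} τ ≤ C_τ16^d(2n+1)^dπ(n)²`) and Chung–Erdős, with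
`a ≥ 2C_τ16^d/c₄²`. [cite: BorgsChayesKestenSpencer2001, Thm. 1.1] [cite: BasuSapozhnikov2017ECP, §1 assumption (A2)] -/
theorem exists_half_le_real_fatUnion_of_setToSetQuasiMultAspectAt (hd : 2 ≤ d) {s L : ℕ} (hs : 2 ≤ s) (hsL : s ≤ L) {ϰ : ℝ}
    (hϰ : 0 < ϰ) (h : SetToSetQuasiMultAspectAt d (criticalProbI d) s L ϰ) :
    ∃ lam : ℝ, 0 < lam ∧ ∃ a : ℕ, 1 ≤ a ∧ ∀ n : ℕ, 1 ≤ n →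
      1 / 2 ≤ (bondPercolation (zdGraph d) (criticalProbI d)).real (⋃ x ∈ box d (a * (2 * n + 1)),
        {ω : BondConfig (Site d) | lam * ((2 * (n : ℝ) + 1) ^ d * oneArmProb d (criticalProbI d) n) ≤
          (((GM.ball x n).filter fun w =>
            ω ∈ (openConnIn (↑(GM.ball x (4 * n)) : Set (Site d)) x w : Set (BondConfig (Site d)))).card : ℝ)}) := by
  classical
  have hd1 : 1 ≤ d := by omega
  obtain ⟨lam, c₄, hlam, hc₄, hloc⟩ := exists_le_real_localVolume_ge_of_setToSetQuasiMultAspectAt hd hs hsL hϰ h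
  obtain ⟨Cτ, hCτ, hsum⟩ := exists_sum_tau_le_of_setToSetQuasiMultAspectAt hd hs hsL hϰ h
  set pc : unitInterval := criticalProbI d with hpcdef
  set μ := bondPercolation (zdGraph d) pc with hμ
  have hpc : 0 < (pc : ℝ) := by rw [hpcdef, coe_criticalProbI]; exact criticalProb_zd_pos d hd1
  have hπpos : ∀ k : ℕ, 0 < oneArmProb d pc k := fun k =>
    (pow_pos hpc k).trans_le (DKT20.pow_le_real_siteToBoundary hd1 pc k)
  set A₀ : ℝ := 2 * Cτ * (16 : ℝ) ^ d / c₄ ^ 2 with hA₀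
  have hA₀0 : 0 ≤ A₀ := by positivity
  set a : ℕ := ⌈A₀⌉₊ + 1 with ha
  have ha1 : 1 ≤ a := by omega
  have haA : A₀ ≤ (a : ℝ) := (Nat.le_ceil A₀).trans (by rw [ha]; push_cast; linarith)
  refine ⟨lam, hlam, a, ha1, fun n hn => ?_⟩
  set R : ℕ := a * (2 * n + 1) with hR
  set t : ℝ := lam * ((2 * (n : ℝ) + 1) ^ d * oneArmProb d pc n) with ht
  have hq : c₄ * oneArmProb d pc n ≤ μ.real {ω : BondConfig (Site d) | t ≤ (((box d n).filter fun z =>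
      ω ∈ (openConnIn (↑(box d (4 * n)) : Set (Site d)) (0 : Site d) z : Set (BondConfig (Site d)))).card : ℝ)} :=
    (hloc n hn).trans (measureReal_mono Set.inter_subset_left (measure_ne_top _ _))
  have hqpos : 0 < c₄ * oneArmProb d pc n := mul_pos hc₄ (hπpos n)
  have hT : ∑ z ∈ box d (8 * n), tau d pc 0 z ≤ Cτ * (16 : ℝ) ^ d * ((2 * (n : ℝ) + 1) ^ d * oneArmProb d pc n ^ 2) := by
    have h1 := hsum (8 * n) (by omega)
    have h2 : oneArmProb d pc (8 * n) ≤ oneArmProb d pc n := DCT16.real_siteToBoundary_antitone pc (by omega)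
    have h3 : (2 * ((8 * n : ℕ) : ℝ) + 1) ^ d ≤ (16 : ℝ) ^ d * (2 * (n : ℝ) + 1) ^ d := by
      rw [← mul_pow]; refine pow_le_pow_left₀ (by positivity) ?_ d; push_cast; linarith
    calc ∑ z ∈ box d (8 * n), tau d pc 0 z ≤ Cτ * ((2 * ((8 * n : ℕ) : ℝ) + 1) ^ d * oneArmProb d pc (8 * n) ^ 2) := h1
      _ ≤ Cτ * ((16 : ℝ) ^ d * (2 * (n : ℝ) + 1) ^ d * oneArmProb d pc n ^ 2) :=
          mul_le_mul_of_nonneg_left (mul_le_mul h3 (pow_le_pow_left₀ measureReal_nonneg h2 2) (sq_nonneg _) (by positivity)) hCτ.le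
      _ = Cτ * (16 : ℝ) ^ d * ((2 * (n : ℝ) + 1) ^ d * oneArmProb d pc n ^ 2) := by ring
  have hcard : ((box d R).card : ℝ) = (2 * (R : ℝ) + 1) ^ d := by rw [card_box]; push_cast; ring
  have hRa : (a : ℝ) * (2 * (n : ℝ) + 1) ≤ 2 * (R : ℝ) + 1 := by rw [hR]; push_cast; nlinarith
  have hpow : (a : ℝ) * (2 * (n : ℝ) + 1) ^ d ≤ (2 * (R : ℝ) + 1) ^ d := by
    have ha1' : (1 : ℝ) ≤ a := by exact_mod_cast ha1
    calc (a : ℝ) * (2 * (n : ℝ) + 1) ^ d ≤ (a : ℝ) ^ d * (2 * (n : ℝ) + 1) ^ d :=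
          mul_le_mul_of_nonneg_right (le_self_pow₀ ha1' (by omega)) (by positivity)
      _ = ((a : ℝ) * (2 * (n : ℝ) + 1)) ^ d := by rw [mul_pow]
      _ ≤ (2 * (R : ℝ) + 1) ^ d := pow_le_pow_left₀ (by positivity) hRa d
  have hden : 0 < ((box d R).card : ℝ) * (c₄ * oneArmProb d pc n) ^ 2 := by
    rw [hcard]; exact mul_pos (by positivity) (pow_pos hqpos 2)
  have hA : 2 * Cτ * (16 : ℝ) ^ d ≤ (a : ℝ) * c₄ ^ 2 := by
    have := mul_le_mul_of_nonneg_right haA (sq_nonneg c₄)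
    rwa [hA₀, div_mul_cancel₀ _ (pow_pos hc₄ 2).ne'] at this
  have hδ : Cτ * (16 : ℝ) ^ d * ((2 * (n : ℝ) + 1) ^ d * oneArmProb d pc n ^ 2) /
      (((box d R).card : ℝ) * (c₄ * oneArmProb d pc n) ^ 2) ≤ 1 / 2 := by
    rw [div_le_iff₀ hden, hcard]
    calc Cτ * (16 : ℝ) ^ d * ((2 * (n : ℝ) + 1) ^ d * oneArmProb d pc n ^ 2)
        = (2 * Cτ * (16 : ℝ) ^ d) * ((2 * (n : ℝ) + 1) ^ d * oneArmProb d pc n ^ 2) / 2 := by ring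
      _ ≤ ((a : ℝ) * c₄ ^ 2) * ((2 * (n : ℝ) + 1) ^ d * oneArmProb d pc n ^ 2) / 2 := by gcongr
      _ = 1 / 2 * (((a : ℝ) * (2 * (n : ℝ) + 1) ^ d) * (c₄ * oneArmProb d pc n) ^ 2) := by ring
      _ ≤ 1 / 2 * ((2 * (R : ℝ) + 1) ^ d * (c₄ * oneArmProb d pc n) ^ 2) := by gcongr
  have hCE := one_sub_real_biUnion_fat_le pc (box d R) ⟨0, zero_mem_box d R⟩ n t hqpos hq hT
  linarith

/-! ## Grid geometry: centres `D·v`, `v ∈ Λ(J)` -/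

/-- Distinct grid points are far apart: `‖D v − D v'‖_∞ ≥ D` for `v ≠ v'`. [folklore] -/
theorem supNorm_sub_smul_ge (hd : 1 ≤ d) {D : ℕ} {v v' : Site d} (hne : v ≠ v') :
    D ≤ Site.supNorm ((fun i => (D : ℤ) * v i) - fun i => (D : ℤ) * v' i) := by
  have _ := hd
  obtain ⟨i, hi⟩ : ∃ i, v i ≠ v' i := by
    by_contra hall; push Not at hall; exact hne (funext hall)
  refine le_trans ?_ (Site.natAbs_le_supNorm _ i)
  simp only [Pi.sub_apply, ← mul_sub, Int.natAbs_mul, Int.natAbs_natCast]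
  have : 1 ≤ (v i - v' i).natAbs := by
    rw [Nat.one_le_iff_ne_zero]; intro h0; exact hi (by rwa [Int.natAbs_eq_zero, sub_eq_zero] at h0)
  exact Nat.le_mul_of_pos_right D this

/-- Grid balls lie in the big box: for `v ∈ Λ(J)` and `D J + r ≤ N`, `Λ_{D v}(r) ⊆ Λ(N)`. [folklore] -/
theorem ball_smul_subset_box {D J r N : ℕ} {v : Site d} (hv : v ∈ box d J) (hN : D * J + r ≤ N) :
    GM.ball (fun i => (D : ℤ) * v i) r ⊆ box d N := by
  intro z hz
  rw [GM.mem_ball] at hz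
  rw [mem_box] at hv ⊢
  intro i
  have h1 := hz i
  have h2 := hv i
  have h3 : -((D : ℤ) * J) ≤ (D : ℤ) * v i ∧ (D : ℤ) * v i ≤ (D : ℤ) * J :=
    ⟨by nlinarith [h2.1, (Nat.cast_nonneg D : (0 : ℤ) ≤ D)], by nlinarith [h2.2, (Nat.cast_nonneg D : (0 : ℤ) ≤ D)]⟩
  have h4 : ((N : ℕ) : ℤ) ≥ (D : ℤ) * J + r := by exact_mod_cast hN
  constructor <;> linarith [h1.1, h1.2, h3.1, h3.2]

/-- The grid has `|Λ(J)| = (2J+1)^d` points (`D ≥ 1`). [folklore] -/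
theorem card_image_smul {D J : ℕ} (hD : 1 ≤ D) :
    ((box d J).image fun v : Site d => fun i => (D : ℤ) * v i).card = (box d J).card := by
  refine Finset.card_image_of_injective _ fun v v' h => ?_
  funext i
  have := congr_fun h i
  have hD0 : (D : ℤ) ≠ 0 := by exact_mod_cast (by omega : D ≠ 0)
  exact mul_left_cancel₀ hD0 this

/-! ## The lower half of BCKS Thm 2 and `k` macroscopic clusters under (A2)□ + blocking -/

/-- **The grid of sealed-cluster centres.**  For `a, n ≥ 1`, `K = 6a + 26` and `N ≥ 2K(2n+1)`, with `R = a(2n+1)`, `R₂ = 3(R+4n+1)+3`,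
`D = 2R₂+1`: the centres `D·v`, `v ∈ Λ(J)`, `J = ⌊(N−R−n)/D⌋`, number `(2J+1)^d ≥ ((2N+1)/(3K(2n+1)))^d`, are at mutual sup-distance
`> 2R₂ ≥ R₂ + R` (pairwise disjoint `Λ_c(R₂)`), and `Λ_c(R+n) ⊆ Λ(N)`. [folklore] -/
theorem exists_grid (hd : 1 ≤ d) {a n N : ℕ} (ha1 : 1 ≤ a) (hn : 1 ≤ n) (hN : 2 * (6 * a + 26) * (2 * n + 1) ≤ N) :
    ∃ cs : Finset (Site d),
      ((2 * (N : ℝ) + 1) / ((3 : ℝ) * ((6 * a + 26 : ℕ) : ℝ) * (2 * (n : ℝ) + 1))) ^ d ≤ (cs.card : ℝ) ∧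
      (∀ c ∈ cs, ∀ c' ∈ cs, c ≠ c' → 3 * (a * (2 * n + 1) + 4 * n + 1) + 3 + a * (2 * n + 1) < Site.supNorm (c - c')) ∧
      (∀ c ∈ cs, ∀ c' ∈ cs, c ≠ c' →
        Disjoint (GM.ball c (3 * (a * (2 * n + 1) + 4 * n + 1) + 3)) (GM.ball c' (3 * (a * (2 * n + 1) + 4 * n + 1) + 3))) ∧
      (∀ c ∈ cs, GM.ball c (a * (2 * n + 1) + n) ⊆ box d N) := by
  classical
  set K : ℕ := 6 * a + 26 with hK
  set R : ℕ := a * (2 * n + 1) with hR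
  set R₂ : ℕ := 3 * (R + 4 * n + 1) + 3 with hR₂def
  set D : ℕ := 2 * R₂ + 1 with hD
  have hD' : D = 6 * R + 24 * n + 13 := by omega
  have hDK : D ≤ K * (2 * n + 1) := by
    have : K * (2 * n + 1) = D + (28 * n + 13) := by rw [hD', hK, hR]; ring
    omega
  have hRn' : R + n ≤ K * (2 * n + 1) := by
    have : K * (2 * n + 1) = R + n + (5 * (a * (2 * n + 1)) + 51 * n + 26) := by rw [hK, hR]; ring
    omega
  have h2K : 2 * K * (2 * n + 1) = 2 * (K * (2 * n + 1)) := by ring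
  have hD1 : 1 ≤ D := by omega
  set J : ℕ := (N - R - n) / D with hJ
  have hRn : R + n ≤ N := by omega
  have hdiv : D * J ≤ N - R - n := by rw [hJ, Nat.mul_comm]; exact Nat.div_mul_le_self _ _
  have hmod : N - R - n < D * J + D := by
    have h1 := Nat.div_add_mod (N - R - n) D
    have h2 := Nat.mod_lt (N - R - n) (by omega : 0 < D)
    rw [← hJ] at h1; omega
  refine ⟨(box d J).image fun v : Site d => fun i => (D : ℤ) * v i, ?_, ?_, ?_, ?_⟩
  · have hcard : ((((box d J).image fun v : Site d => fun i => (D : ℤ) * v i).card : ℕ) : ℝ) = (2 * (J : ℝ) + 1) ^ d := by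
      rw [card_image_smul hD1, card_box]; push_cast; ring
    rw [hcard]
    refine pow_le_pow_left₀ (by positivity) ?_ d
    have hK0 : (0 : ℝ) < (3 : ℝ) * K * (2 * (n : ℝ) + 1) := by positivity
    rw [div_le_iff₀ hK0]
    -- in ℕ: `2N + 1 ≤ (2J+1)·3K(2n+1)` from `N − R − n < D(J+1)`, `D ≤ K(2n+1)`, `R + n ≤ K(2n+1)`, `N ≥ 2K(2n+1)`, `J ≥ 1`
    have hnat : 2 * N + 1 ≤ (2 * J + 1) * (3 * K * (2 * n + 1)) := by
      have hJ1 : 1 ≤ J := by rw [hJ, Nat.le_div_iff_mul_le (by omega)]; omega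
      have e1 : (2 * J + 1) * (3 * K * (2 * n + 1)) = 6 * (K * (2 * n + 1) * J) + 3 * (K * (2 * n + 1)) := by ring
      have e2 : D * J ≤ K * (2 * n + 1) * J := Nat.mul_le_mul_right J hDK
      have e3 : K * (2 * n + 1) ≤ K * (2 * n + 1) * J := Nat.le_mul_of_pos_right _ (by omega)
      omega
    exact_mod_cast hnat
  · intro c hc c' hc' hcc'
    rw [Finset.mem_image] at hc hc'
    obtain ⟨v, hv, rfl⟩ := hc
    obtain ⟨v', hv', rfl⟩ := hc'
    have hvv' : v ≠ v' := fun h' => hcc' (by rw [h'])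
    have := supNorm_sub_smul_ge hd (D := D) hvv'
    omega
  · intro c hc c' hc' hcc'
    rw [Finset.mem_image] at hc hc'
    obtain ⟨v, hv, rfl⟩ := hc
    obtain ⟨v', hv', rfl⟩ := hc'
    have hvv' : v ≠ v' := fun h' => hcc' (by rw [h'])
    have := supNorm_sub_smul_ge hd (D := D) hvv'
    exact disjoint_ball_of_add_lt (by omega)
  · intro c hc
    rw [Finset.mem_image] at hc
    obtain ⟨v, hv, rfl⟩ := hc
    exact ball_smul_subset_box hv (by omega)

open Classical in
/-- **THE LOWER HALF OF BCKS THM 2 UNDER (A2)□ + ANNULUS BLOCKING** (`p_c(ℤ^d)`, `d ≥ 2`, (A2)□ at `(s,L)`, `2 ≤ s ≤ L`, `ϰ > 0`, and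
`c_B ≤ 1 − P_{p_c}(boxCrossing d m (3m+3))` for all `m ≥ 1`, `c_B > 0`): there are `λ, c > 0` and `C₀` with
`c · ((2N+1)/(2n+1))^d ≤ E_{p_c} N_{λ s(n)}(Λ_N)` for all `n ≥ 1`, `N ≥ C₀(2n+1)` (`s(n) = (2n+1)^dπ_{p_c}(n)`) — a grid of `≍ (N/n)^d` centres
(`exists_grid`), each sealed with probability `≥ c_B/2` (part VIII).  With part V: `E_{p_c} N_{λs(n)}(Λ_N) ≍ (N/n)^d`, the number of clusters of
scale `n` in the box of scale `N` is a function of `N/n` only.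
[cite: BorgsChayesKestenSpencer2001, Thm. 2 of Chayes' ICM 1998 report: C₁(n/m)^d ≤ E N_{Λ_n}(s(m), s(km)) ≤ C₂(n/m)^d] [cite: BasuSapozhnikov2017ECP, §1 assumption (A2)] -/
theorem exists_le_integral_numFat_scale_of_setToSetQuasiMultAspectAt (hd : 2 ≤ d) {s L : ℕ} (hs : 2 ≤ s) (hsL : s ≤ L)
    {ϰ : ℝ} (hϰ : 0 < ϰ) (h : SetToSetQuasiMultAspectAt d (criticalProbI d) s L ϰ) {cB : ℝ} (hcB : 0 < cB)
    (hB : ∀ m : ℕ, 1 ≤ m → cB ≤ 1 - (bondPercolation (zdGraph d) (criticalProbI d)).real (boxCrossing d m (3 * m + 3))) :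
    ∃ lam c : ℝ, 0 < lam ∧ 0 < c ∧ ∃ C₀ : ℕ, ∀ n N : ℕ, 1 ≤ n → C₀ * (2 * n + 1) ≤ N →
      c * ((2 * (N : ℝ) + 1) / (2 * (n : ℝ) + 1)) ^ d ≤
        ∫ ω, ((((box d N).filter fun y =>
          lam * ((2 * (n : ℝ) + 1) ^ d * oneArmProb d (criticalProbI d) n) ≤ ((((box d N).filter fun w =>
            ω ∈ (openConn y w : Set (BondConfig (Site d)))).card : ℕ) : ℝ)).image fun y =>
          (box d N).filter fun w => ω ∈ (openConn y w : Set (BondConfig (Site d)))).card : ℝ)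
          ∂(bondPercolation (zdGraph d) (criticalProbI d)) := by
  classical
  have hd1 : 1 ≤ d := by omega
  obtain ⟨lam, hlam, a, ha1, hU⟩ := exists_half_le_real_fatUnion_of_setToSetQuasiMultAspectAt hd hs hsL hϰ h
  set pc : unitInterval := criticalProbI d with hpcdef
  set μ := bondPercolation (zdGraph d) pc with hμ
  have hpc : 0 < (pc : ℝ) := by rw [hpcdef, coe_criticalProbI]; exact criticalProb_zd_pos d hd1
  have hπpos : ∀ k : ℕ, 0 < oneArmProb d pc k := fun k =>
    (pow_pos hpc k).trans_le (DKT20.pow_le_real_siteToBoundary hd1 pc k)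
  set K : ℕ := 6 * a + 26 with hK
  refine ⟨lam, cB / 2 / ((3 : ℝ) * K) ^ d, hlam, by positivity, 2 * K, fun n N hn hN => ?_⟩
  obtain ⟨cs, hcard, hfar, -, hballs⟩ := exists_grid (d := d) hd1 ha1 hn hN
  set R : ℕ := a * (2 * n + 1) with hR
  set R₂ : ℕ := 3 * (R + 4 * n + 1) + 3 with hR₂def
  have hR₂ : R + 4 * n + 1 ≤ R₂ := by omega
  set t : ℝ := lam * ((2 * (n : ℝ) + 1) ^ d * oneArmProb d pc n) with ht
  have htpos : 0 < t := mul_pos hlam (mul_pos (by positivity) (hπpos n))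
  have hVIII := card_mul_le_integral_numFat pc (n := n) (R := R) (R₂ := R₂) (N := N) htpos hR₂
    (fun c hc c' hc' hcc' => by have := hfar c hc c' hc' hcc'; omega) hballs
  have hseal : cB / 2 ≤ μ.real (⋃ x ∈ box d R, {ω : BondConfig (Site d) | t ≤ (((GM.ball x n).filter fun w =>
      ω ∈ (openConnIn (↑(GM.ball x (4 * n)) : Set (Site d)) x w : Set (BondConfig (Site d)))).card : ℝ)}) *
      (1 - μ.real (boxCrossing d (R + 4 * n + 1) R₂)) := by
    have h1 := hU n hn
    have h2 : cB ≤ 1 - μ.real (boxCrossing d (R + 4 * n + 1) R₂) := by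
      have := hB (R + 4 * n + 1) (by omega); rwa [hR₂def]
    calc cB / 2 = 1 / 2 * cB := by ring
      _ ≤ _ := mul_le_mul h1 h2 hcB.le measureReal_nonneg
  calc cB / 2 / ((3 : ℝ) * K) ^ d * ((2 * (N : ℝ) + 1) / (2 * (n : ℝ) + 1)) ^ d
      = cB / 2 * ((2 * (N : ℝ) + 1) / ((3 : ℝ) * K * (2 * (n : ℝ) + 1))) ^ d := by
        have hx : (2 * (N : ℝ) + 1) / ((3 : ℝ) * K * (2 * (n : ℝ) + 1)) =
            (2 * (N : ℝ) + 1) / (2 * (n : ℝ) + 1) / ((3 : ℝ) * K) := by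
          rw [div_div, mul_comm (2 * (n : ℝ) + 1)]
        rw [hx, div_pow _ ((3 : ℝ) * K)]; ring
    _ ≤ cB / 2 * (cs.card : ℝ) := mul_le_mul_of_nonneg_left (by rw [hK]; exact hcard) (by positivity)
    _ = (cs.card : ℝ) * (cB / 2) := mul_comm _ _
    _ ≤ (cs.card : ℝ) * (μ.real (⋃ x ∈ box d R, {ω : BondConfig (Site d) | t ≤ (((GM.ball x n).filter fun w =>
          ω ∈ (openConnIn (↑(GM.ball x (4 * n)) : Set (Site d)) x w : Set (BondConfig (Site d)))).card : ℝ)}) *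
        (1 - μ.real (boxCrossing d (R + 4 * n + 1) R₂))) := mul_le_mul_of_nonneg_left hseal (Nat.cast_nonneg _)
    _ ≤ _ := hVIII

open Classical in
/-- **`k` DISTINCT MACROSCOPIC CLUSTERS UNDER (A2)□ + ANNULUS BLOCKING** (`p_c(ℤ^d)`, `d ≥ 2`, hypotheses as above): for every `k` there are
`ε, c > 0` and `N₀` with `c ≤ P_{p_c}( k ≤ N_{ε s(N)}(Λ_N) )` for all `N ≥ N₀` — with probability bounded below the box contains `k` distinct
open clusters, each of the size `≍ |Λ_N|π_{p_c}(N)` of the largest one (part VIII's independence on a grid of `(2k+1)^d ≥ k` centres at fat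
scale `n ≍ N/k`). [cite: BorgsChayesKestenSpencer2001, Thm. 1.1] [cite: BasuSapozhnikov2017ECP, §1 assumption (A2)] -/
theorem exists_le_real_le_numFat_of_setToSetQuasiMultAspectAt (hd : 2 ≤ d) {s L : ℕ} (hs : 2 ≤ s) (hsL : s ≤ L)
    {ϰ : ℝ} (hϰ : 0 < ϰ) (h : SetToSetQuasiMultAspectAt d (criticalProbI d) s L ϰ) {cB : ℝ} (hcB : 0 < cB)
    (hB : ∀ m : ℕ, 1 ≤ m → cB ≤ 1 - (bondPercolation (zdGraph d) (criticalProbI d)).real (boxCrossing d m (3 * m + 3))) (k : ℕ) :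
    ∃ ε c : ℝ, 0 < ε ∧ 0 < c ∧ ∃ N₀ : ℕ, ∀ N : ℕ, N₀ ≤ N →
      c ≤ (bondPercolation (zdGraph d) (criticalProbI d)).real {ω | k ≤ (((box d N).filter fun y =>
          ε * ((2 * (N : ℝ) + 1) ^ d * oneArmProb d (criticalProbI d) N) ≤ ((((box d N).filter fun w =>
            ω ∈ (openConn y w : Set (BondConfig (Site d)))).card : ℕ) : ℝ)).image fun y =>
          (box d N).filter fun w => ω ∈ (openConn y w : Set (BondConfig (Site d)))).card} := by
  classical
  have hd1 : 1 ≤ d := by omega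
  obtain ⟨lam, hlam, a, ha1, hU⟩ := exists_half_le_real_fatUnion_of_setToSetQuasiMultAspectAt hd hs hsL hϰ h
  set pc : unitInterval := criticalProbI d with hpcdef
  set μ := bondPercolation (zdGraph d) pc with hμ
  have hpc : 0 < (pc : ℝ) := by rw [hpcdef, coe_criticalProbI]; exact criticalProb_zd_pos d hd1
  have hπpos : ∀ k : ℕ, 0 < oneArmProb d pc k := fun k =>
    (pow_pos hpc k).trans_le (DKT20.pow_le_real_siteToBoundary hd1 pc k)
  set L₀ : ℕ := (6 * a + 26) * k + a + 1 with hL₀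
  have hL₀1 : 1 ≤ L₀ := by omega
  refine ⟨lam / (4 * (L₀ : ℝ)) ^ d, (cB / 2) ^ ((2 * k + 1) ^ d), by positivity, by positivity, 8 * L₀, fun N hN => ?_⟩
  set n : ℕ := (N - L₀) / (2 * L₀) with hn
  have hn1 : 1 ≤ n := by rw [hn, Nat.le_div_iff_mul_le (by omega)]; omega
  have hdiv : n * (2 * L₀) ≤ N - L₀ := Nat.div_mul_le_self _ _
  have hmod : N - L₀ < n * (2 * L₀) + 2 * L₀ := by
    have h1 := Nat.div_add_mod (N - L₀) (2 * L₀)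
    have h2 := Nat.mod_lt (N - L₀) (by omega : 0 < 2 * L₀)
    rw [← hn] at h1
    have : 2 * L₀ * n = n * (2 * L₀) := Nat.mul_comm _ _
    omega
  set R : ℕ := a * (2 * n + 1) with hR
  set R₂ : ℕ := 3 * (R + 4 * n + 1) + 3 with hR₂def
  set D : ℕ := 2 * R₂ + 1 with hD
  have hR₂ : R + 4 * n + 1 ≤ R₂ := by omega
  have hD1 : 1 ≤ D := by omega
  have hgeom : D * k + R + n ≤ N := by
    have hD' : D = 6 * R + 24 * n + 13 := by omega
    have e1 : L₀ * (2 * n + 1) = D * k + R + n + (28 * n * k + 13 * k + n + 1) := by rw [hL₀, hD', hR]; ring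
    have e2 : L₀ * (2 * n + 1) = n * (2 * L₀) + L₀ := by ring
    omega
  set cs : Finset (Site d) := (box d k).image fun v : Site d => fun i => (D : ℤ) * v i with hcs
  have hcard : cs.card = (2 * k + 1) ^ d := by rw [hcs, card_image_smul hD1, card_box]
  have hfar : ∀ c ∈ cs, ∀ c' ∈ cs, c ≠ c' → R₂ + R < Site.supNorm (c - c') := by
    intro c hc c' hc' hcc'
    rw [hcs, Finset.mem_image] at hc hc'
    obtain ⟨v, hv, rfl⟩ := hc
    obtain ⟨v', hv', rfl⟩ := hc'
    have hvv' : v ≠ v' := fun h' => hcc' (by rw [h'])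
    have := supNorm_sub_smul_ge hd1 (D := D) hvv'
    omega
  have hdisj : ∀ c ∈ cs, ∀ c' ∈ cs, c ≠ c' → Disjoint (GM.ball c R₂) (GM.ball c' R₂) := by
    intro c hc c' hc' hcc'
    rw [hcs, Finset.mem_image] at hc hc'
    obtain ⟨v, hv, rfl⟩ := hc
    obtain ⟨v', hv', rfl⟩ := hc'
    have hvv' : v ≠ v' := fun h' => hcc' (by rw [h'])
    have := supNorm_sub_smul_ge hd1 (D := D) hvv'
    exact disjoint_ball_of_add_lt (by omega)
  have hballs : ∀ c ∈ cs, GM.ball c (R + n) ⊆ box d N := by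
    intro c hc
    rw [hcs, Finset.mem_image] at hc
    obtain ⟨v, hv, rfl⟩ := hc
    exact ball_smul_subset_box hv (by omega)
  set t : ℝ := lam * ((2 * (n : ℝ) + 1) ^ d * oneArmProb d pc n) with ht
  have hVIII := pow_card_le_real_le_numFat pc (n := n) (R := R) (R₂ := R₂) (N := N) t hR₂ hfar hdisj hballs
  rw [hcard] at hVIII
  have hseal : cB / 2 ≤ μ.real (⋃ x ∈ box d R, {ω : BondConfig (Site d) | t ≤ (((GM.ball x n).filter fun w =>
      ω ∈ (openConnIn (↑(GM.ball x (4 * n)) : Set (Site d)) x w : Set (BondConfig (Site d)))).card : ℝ)}) *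
      (1 - μ.real (boxCrossing d (R + 4 * n + 1) R₂)) := by
    have h1 := hU n hn1
    have h2 : cB ≤ 1 - μ.real (boxCrossing d (R + 4 * n + 1) R₂) := by
      have := hB (R + 4 * n + 1) (by omega); rwa [hR₂def]
    calc cB / 2 = 1 / 2 * cB := by ring
      _ ≤ _ := mul_le_mul h1 h2 hcB.le measureReal_nonneg
  have hlevel : lam / (4 * (L₀ : ℝ)) ^ d * ((2 * (N : ℝ) + 1) ^ d * oneArmProb d pc N) ≤ t := by
    have hπ : oneArmProb d pc N ≤ oneArmProb d pc n := DCT16.real_siteToBoundary_antitone pc (by omega)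
    have hL0 : (0 : ℝ) < 4 * (L₀ : ℝ) := by positivity
    have h2N : (2 * (N : ℝ) + 1) ≤ 4 * (L₀ : ℝ) * (2 * (n : ℝ) + 1) := by
      have hnat : 2 * N + 1 ≤ 4 * L₀ * (2 * n + 1) := by
        have e : 4 * L₀ * (2 * n + 1) = 4 * (n * (2 * L₀)) + 4 * L₀ := by ring
        have hP : 2 * L₀ ≤ n * (2 * L₀) := Nat.le_mul_of_pos_left _ (by omega)
        omega
      exact_mod_cast hnat
    calc lam / (4 * (L₀ : ℝ)) ^ d * ((2 * (N : ℝ) + 1) ^ d * oneArmProb d pc N)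
        = lam * (((2 * (N : ℝ) + 1) / (4 * (L₀ : ℝ))) ^ d * oneArmProb d pc N) := by rw [div_pow]; field_simp
      _ ≤ lam * ((2 * (n : ℝ) + 1) ^ d * oneArmProb d pc n) :=
          mul_le_mul_of_nonneg_left (mul_le_mul (pow_le_pow_left₀ (by positivity) ((div_le_iff₀ hL0).2 (by linarith)) d)
            hπ measureReal_nonneg (by positivity)) hlam.le
  have hk : k ≤ (2 * k + 1) ^ d := by
    calc k ≤ 2 * k + 1 := by omega
      _ = (2 * k + 1) ^ 1 := (pow_one _).symm
      _ ≤ (2 * k + 1) ^ d := Nat.pow_le_pow_right (by omega) hd1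
  calc (cB / 2) ^ ((2 * k + 1) ^ d)
      ≤ (μ.real (⋃ x ∈ box d R, {ω : BondConfig (Site d) | t ≤ (((GM.ball x n).filter fun w =>
          ω ∈ (openConnIn (↑(GM.ball x (4 * n)) : Set (Site d)) x w : Set (BondConfig (Site d)))).card : ℝ)}) *
        (1 - μ.real (boxCrossing d (R + 4 * n + 1) R₂))) ^ ((2 * k + 1) ^ d) := pow_le_pow_left₀ (by positivity) hseal _
    _ ≤ μ.real {ω | (2 * k + 1) ^ d ≤ (((box d N).filter fun y => t ≤ ((((box d N).filter fun w =>
        ω ∈ (openConn y w : Set (BondConfig (Site d)))).card : ℕ) : ℝ)).image fun y =>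
          (box d N).filter fun w => ω ∈ (openConn y w : Set (BondConfig (Site d)))).card} := hVIII
    _ ≤ _ := measureReal_mono (fun ω hω => hk.trans (le_trans hω (card_image_cluster_anti N hlevel ω))) (measure_ne_top _ _)

end Rsw3

end Summit.CriticalPhenomena.PercolationContinuityZ3.Theorems
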